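import Summits.ResolutionOfSingularities.ResolutionOfSingularities.Theorems.PurelyInseparableDim4ChartAtlasCover
import Summits.ResolutionOfSingularities.ResolutionOfSingularities.Theorems.PurelyInseparableDim4ChartClosureAdmissible
import HarnessLib

/-!
# Purely inseparable four-folds `z^p + F(x₁, …, x₄)`: THE ATLAS OF AN ESCAPING GLOBAL CENTRE — the package on the walk's
# data (brick S3-N1 «atlas of an escaping global centre», part E4; cell `res-dim4-pi`, typ-2 g5)

[OURS · counted 0] (D-0157 DOOR 2; DR-157-C; desk WORD #115 (a) (S3-N1); typ-3 g4 `S3c-V3-DESIGN.md` «a member carries a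
finite ATLAS of zigzag charts: each reads `M'` as `hypSheaf p s_α.F` and `vanishingIdeal c` as `𝓘Λ S_α`, and
`c ⊆ ⋃_α range φ_α`»; frame `PIDim4.TerminationImpliesOrderReduction`, S3 (c)). ASSEMBLY of E1/E1b/E2/E3 with typ-2 g4's
depth-2 package D3 (`globalCentre_admissible_package_of_not_mem`), on the walk's own data: a presented state `s` with
`s.F ≠ 0` CLEAN, a Hironaka-permissible `S ∋ j`, ANY blowing up `π : W → 𝔸⁵_K` along `V(z, x_S)`, a point `b` of the
exceptional hyperplane of the `x_j`-chart (`b_j = 0`), and a next coordinate centre `S' ∌ j` permissible for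
`step p S j b s` — escaping (`S ∖ {j} ⊄ S'`) or not:

* **`globalCentre_atlas_package_of_not_mem`** — with `Θⱼ` the re-centring of record of the `x_j`-chart (translation by `b`
  then cleaning), `φⱼ = Spec Θⱼ ≫ chartImm_j`, `Zc = 𝓘(closure φⱼ(V(z, x_{S'})))`, `M' = ((z^p + s.F)·𝒪, [], p).transform π`:
  (D3) `φⱼ` reads `M'` as `(z^p + (step p S j b s).F)·𝒪` and `Zc` as `𝓘Λ_{S'}`; `Zc` is regular, `⊆ supp M'`, snc with
  `M'.boundary`; (E3) **`V(Zc) ⊆ ⋃_{l ∈ S ∖ S'} W[⊤, x_l]`**; and (E1/E1b/E2) for EVERY `l ∈ S ∖ S'`, `l ≠ j`, there are a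
  shear re-centring `Θ_l` of the `x_l`-chart (`Θ_l z = z + g_l`, `Θ_l|_{K[x]} = τ_l` the base shear: `x_j, x_l` fixed,
  `xᵢ ↦ xᵢ + bᵢ x_j` on `S ∖ {j, l}`, `x_k ↦ x_k + b_k` off `S`) and a polynomial `F_l = g_l^p + τ_l(chartTransform p S l s.F)`
  with: `φ_l := Spec Θ_l ≫ chartImm_l` reads `M'` as `(z^p + F_l)·𝒪` and `Zc` as `𝓘Λ_{S'}` (the SAME `S'`), `F_l ≠ 0`,
  `F_l` CLEAN, `p ≤ ord_{(x_{S'})} F_l` (Hironaka-permissible again), and the exceptional component `π⁻¹𝓘Λ_S·𝒪_W` reads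
  `x_l·𝒪` on `φ_l`.

This is the finite atlas `{(φⱼ, (step p S j b s).F, S')} ∪ {(φ_l, F_l, S') : l ∈ S ∖ S', l ≠ j}` of the escaping child for
typ-3's joint forest v3. HONEST SCOPE: `K` algebraically closed of characteristic `p`; depth 2 (boundary `[E₁]`) for the
snc conjunct, every other conjunct is boundary-free; the case `j ∈ S'` (closure inside `E₁`), the shape of OLDER boundary
members (S3-N2), the walk over the added points and termination are NOT addressed; resolution of singularities in
dimension ≥ 4 / characteristic `p` is NOT proved anywhere in this programme. bears_on: LADDER-RESOLUTION:D157-DOOR2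
(res-dim4-pi). Supports stmt-ResolutionOfSingularities-16155 (helper, S3-N1 E4).
-/

-- every declaration of this summit lives under `Summit.ResolutionOfSingularities.ResolutionOfSingularities`
-- (summit = problem), which the duplicate-namespace linter flags; house convention (cf. the Target file).
set_option linter.dupNamespace false

noncomputable section

open MvPolynomial Finset CategoryTheory AlgebraicGeometry Opposite TopologicalSpace
open AlgebraicGeometry.Scheme.IdealSheafData (ofIdealTop vanishingIdeal)

namespace Summit.ResolutionOfSingularities.ResolutionOfSingularities.Theorems.PIDim4

open Literature.AlgebraicGeometry.Resolution
open Literature.AlgebraicGeometry.Resolution.Hauser2010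
open Literature.AlgebraicGeometry.Resolution.AffinePointBlowup (P A γ coord Wtop ξ)
open Literature.Barriers.ResolutionOfSingularities

namespace ChartDictionary

variable {K : Type} [Field K] {p : ℕ} [hp : Fact p.Prime] [CharP K p]
  {S S' : Finset (Fin 4)} {j : Fin 4} {b : Fin 4 → K} {W : Scheme.{0}} {π : W ⟶ P 4 K}

/-- **One chart of the atlas.** Given the `x_j`-chart data of the package (re-centring `Θⱼ` reading the transform, `S'`
permissible for the reading, the lift `H`), for every other centre variable `l ∈ S ∖ S'` there is a CLEANED shear
re-centring of the `x_l`-chart reading `Zc` as `𝓘Λ_{S'}` and the transform as a clean, permissible, non-zero `z^p + F_l`. -/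
theorem exists_shear_chart_reading [IsAlgClosed K] (hj : j ∈ S) (hjS' : j ∉ S') (hbj : b j = 0)
    {Θⱼ : A 4 K ≃ₐ[K] A 4 K} {h : MvPolynomial (Fin 4) K} {F F₁ : MvPolynomial (Fin 4) K}
    (hF : F ≠ 0) (hclean : HauserPerlega.IsClean p F)
    (h0j : Θⱼ (X 0) = X 0 + rename Fin.succ h) (hsj : ∀ i : Fin 4, Θⱼ (X i.succ) = X i.succ + C (b i))
    (hπ : IsBlowup π (AffineCoordBlowup.𝓘Λ 4 K (insert 0 (Fin.succ '' (S : Set (Fin 4))))))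
    (hperm : (p : ℕ∞) ≤ CentreBlowup.ordAlong S F)
    (hread : Θⱼ (coordBlowupSubst K (insert 0 (Fin.succ '' (S : Set (Fin 4)))) j.succ (hyp p F)) =
      X j.succ ^ p * hyp p F₁)
    (hperm' : (p : ℕ∞) ≤ CentreBlowup.ordAlong S' F₁) {l : Fin 4} (hl : l ∈ S) (hlS' : l ∉ S') (hjl : j ≠ l) :
    haveI : IsIso (CommRingCat.ofHom (Θⱼ : A 4 K →+* A 4 K)) :=
      (inferInstance : IsIso Θⱼ.toRingEquiv.toCommRingCatIso.hom)
    ∃ (Θ : A 4 K ≃ₐ[K] A 4 K) (τ : MvPolynomial (Fin 4) K ≃ₐ[K] MvPolynomial (Fin 4) K) (g : MvPolynomial (Fin 4) K)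
      (_ : IsIso (CommRingCat.ofHom (Θ : A 4 K →+* A 4 K))),
      Θ (X 0) = X 0 + rename Fin.succ g ∧ (∀ i : Fin 4, Θ (X i.succ) = rename Fin.succ (τ (X i))) ∧
      τ (X j) = X j ∧ τ (X l) = X l ∧ (∀ i ∈ S, i ≠ j → i ≠ l → τ (X i) = X i + C (b i) * X j) ∧
      (∀ k ∉ S, τ (X k) = X k + C (b k)) ∧
      let φ := Spec.map (CommRingCat.ofHom (Θ : A 4 K →+* A 4 K)) ≫ AffineCoordBlowup.chartImm hπ (succ_mem_centreVars hl)
      let Zc := vanishingIdeal (closureImage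
        (Spec.map (CommRingCat.ofHom (Θⱼ : A 4 K →+* A 4 K)) ≫ AffineCoordBlowup.chartImm hπ (succ_mem_centreVars hj))
        ((AffineCoordBlowup.𝓘Λ 4 K (insert 0 (Fin.succ '' (S' : Set (Fin 4))))).support : Set (P 4 K)))
      let M' := ((⟨hypSheaf p F, [], p⟩ : MarkedIdeal (P 4 K)).transform π
        (AffineCoordBlowup.𝓘Λ 4 K (insert 0 (Fin.succ '' (S : Set (Fin 4))))))
      let Fl := g ^ p + τ (CentreBlowup.chartTransform p S l F)
      M'.ideal.comap φ = hypSheaf p Fl ∧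
      Zc.comap φ = AffineCoordBlowup.𝓘Λ 4 K (insert 0 (Fin.succ '' (S' : Set (Fin 4)))) ∧
      Fl ≠ 0 ∧ HauserPerlega.IsClean p Fl ∧ (p : ℕ∞) ≤ CentreBlowup.ordAlong S' Fl ∧
      ((AffineCoordBlowup.𝓘Λ 4 K (insert 0 (Fin.succ '' (S : Set (Fin 4))))).comap π).comap φ =
        ofIdealTop (Ideal.span {(γ 4 K).symm (X l.succ + C 0)}) := by
  haveI : IsIso (CommRingCat.ofHom (Θⱼ : A 4 K →+* A 4 K)) :=
    (inferInstance : IsIso Θⱼ.toRingEquiv.toCommRingCatIso.hom)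
  haveI : PerfectRing K p := PerfectRing.ofSurjective K p fun x => IsAlgClosed.exists_pow_nat_eq x hp.out.pos
  -- the lift `H` of the `x_j`-chart and its `x_l`-chart quotient `H_l`
  obtain ⟨H, hH⟩ := exists_lift_twist hj hbj h0j hsj hperm hread hperm'
  obtain ⟨Hl, hHl⟩ := exists_coordBlowupSubst_eq_X_mul_of_mem_span hl (mem_span_X_of_lift hj hH)
  -- the base shear and the RAW re-centring `g₀ = τ H_l`
  obtain ⟨τ, hτj, hτl, hτS, hτb⟩ := exists_algEquiv_shearBase hj hl b
  have hτ1 : ∀ i ∈ S' ∩ S, τ (X i) = X i + C (b i) * X j := fun i hi => by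
    obtain ⟨hiS', hiS⟩ := Finset.mem_inter.mp hi
    exact hτS i hiS (fun e => hjS' (e ▸ hiS')) (fun e => hlS' (e ▸ hiS'))
  have hτ2 : ∀ k ∈ S' \ S, τ (X k) = X k + C (b k) := fun k hk => hτb k (Finset.mem_sdiff.mp hk).2
  obtain ⟨Θ₀, h0₀, hτ₀⟩ := exists_algEquiv_shear_lift (K := K) τ (τ Hl)
  have hg₀ : τ Hl - τ Hl ∈ Ideal.span (X '' (S' : Set (Fin 4)) : Set (MvPolynomial (Fin 4) K)) := by
    rw [sub_self]; exact Ideal.zero_mem _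
  -- permissibility of the raw reading (Q2 read back on the chart), then clean it keeping the centre
  have hperm₀ := le_ordAlong_shear_reading hj hjS' hbj h0j hsj hπ hperm hread hperm' hH hl hlS' hjl h0₀ hτ₀ hτl hτj
    hτ1 hτ2 hHl hg₀
  obtain ⟨g, hg, hgeq, hgclean, -⟩ := exists_clean_shear_root (S' := S') (τ Hl) (τ (CentreBlowup.chartTransform p S l F))
    (τ Hl) hg₀ hperm₀
  obtain ⟨Θ, h0, hτ⟩ := exists_algEquiv_shear_lift (K := K) τ g
  haveI hiso : IsIso (CommRingCat.ofHom (Θ : A 4 K →+* A 4 K)) :=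
    (inferInstance : IsIso Θ.toRingEquiv.toCommRingCatIso.hom)
  refine ⟨Θ, τ, g, hiso, h0, hτ, hτj, hτl, hτS, hτb, ?_, ?_, ?_, hgclean, ?_, ?_⟩
  · exact comap_shear_chart_transform_ideal hl h0 hτ hπ hperm _ rfl rfl
  · exact comap_shear_chart_globalCentre hj hjS' hbj h0j hsj hπ hH hl hlS' hjl h0 hτ hτl hτj hτ1 hτ2 hHl hg
  · rw [hgeq]
    exact deletePthPowers_shear_reading_ne_zero hl hF hclean hperm τ (τ Hl)
  · exact le_ordAlong_shear_reading hj hjS' hbj h0j hsj hπ hperm hread hperm' hH hl hlS' hjl h0 hτ hτl hτj hτ1 hτ2 hHl hg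
  · exact comap_shear_chart_exceptional hl hτ hτl hπ

/-- **THE ATLAS OF AN ESCAPING GLOBAL CENTRE (S3-N1, typ-2 side), on the walk's own data** — see the module docstring. -/
theorem globalCentre_atlas_package_of_not_mem [IsAlgClosed K] [DecidableEq K] (hj : j ∈ S) (hjS' : j ∉ S')
    (hbj : b j = 0) (s : State K) (hF : s.F ≠ 0) (hclean : HauserPerlega.IsClean p s.F)
    (hperm : (p : ℕ∞) ≤ CentreBlowup.ordAlong S s.F)
    (hπ : IsBlowup π (AffineCoordBlowup.𝓘Λ 4 K (insert 0 (Fin.succ '' (S : Set (Fin 4))))))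
    (hperm' : (p : ℕ∞) ≤ CentreBlowup.ordAlong S' (CentreBlowup.step p S j b s).F) :
    ∃ (Θⱼ : A 4 K ≃ₐ[K] A 4 K) (h : MvPolynomial (Fin 4) K) (_ : IsIso (CommRingCat.ofHom (Θⱼ : A 4 K →+* A 4 K))),
      Θⱼ (X 0) = X 0 + rename Fin.succ h ∧ (∀ i : Fin 4, Θⱼ (X i.succ) = X i.succ + C (b i)) ∧
      let φⱼ := Spec.map (CommRingCat.ofHom (Θⱼ : A 4 K →+* A 4 K)) ≫ AffineCoordBlowup.chartImm hπ (succ_mem_centreVars hj)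
      let Zc := vanishingIdeal (closureImage φⱼ ((AffineCoordBlowup.𝓘Λ 4 K
        (insert 0 (Fin.succ '' (S' : Set (Fin 4))))).support : Set (P 4 K)))
      let M' := ((⟨hypSheaf p s.F, [], p⟩ : MarkedIdeal (P 4 K)).transform π
        (AffineCoordBlowup.𝓘Λ 4 K (insert 0 (Fin.succ '' (S : Set (Fin 4))))))
      (M'.ideal.comap φⱼ = hypSheaf p (CentreBlowup.step p S j b s).F ∧
        Zc.comap φⱼ = AffineCoordBlowup.𝓘Λ 4 K (insert 0 (Fin.succ '' (S' : Set (Fin 4)))) ∧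
        Scheme.IsRegular Zc.subscheme ∧ (Zc.support : Set W) ⊆ M'.support ∧ HasSNCWith M'.boundary Zc) ∧
      ((Zc.support : Set W) ⊆ ⋃ (l : Fin 4) (hl : l ∈ S \ S'),
        ((AffineCoordBlowup.chartImm hπ (succ_mem_centreVars (Finset.mem_sdiff.mp hl).1)).opensRange : Set W)) ∧
      ∀ (l : Fin 4) (hl : l ∈ S), l ∉ S' → j ≠ l →
        ∃ (Θ : A 4 K ≃ₐ[K] A 4 K) (τ : MvPolynomial (Fin 4) K ≃ₐ[K] MvPolynomial (Fin 4) K) (g : MvPolynomial (Fin 4) K)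
          (_ : IsIso (CommRingCat.ofHom (Θ : A 4 K →+* A 4 K))),
          Θ (X 0) = X 0 + rename Fin.succ g ∧ (∀ i : Fin 4, Θ (X i.succ) = rename Fin.succ (τ (X i))) ∧
          τ (X j) = X j ∧ τ (X l) = X l ∧ (∀ i ∈ S, i ≠ j → i ≠ l → τ (X i) = X i + C (b i) * X j) ∧
          (∀ k ∉ S, τ (X k) = X k + C (b k)) ∧
          let φ := Spec.map (CommRingCat.ofHom (Θ : A 4 K →+* A 4 K)) ≫
            AffineCoordBlowup.chartImm hπ (succ_mem_centreVars hl)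
          let Fl := g ^ p + τ (CentreBlowup.chartTransform p S l s.F)
          M'.ideal.comap φ = hypSheaf p Fl ∧
          Zc.comap φ = AffineCoordBlowup.𝓘Λ 4 K (insert 0 (Fin.succ '' (S' : Set (Fin 4)))) ∧
          Fl ≠ 0 ∧ HauserPerlega.IsClean p Fl ∧ (p : ℕ∞) ≤ CentreBlowup.ordAlong S' Fl ∧
          ((AffineCoordBlowup.𝓘Λ 4 K (insert 0 (Fin.succ '' (S : Set (Fin 4))))).comap π).comap φ =
            ofIdealTop (Ideal.span {(γ 4 K).symm (X l.succ + C 0)}) := by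
  haveI : PerfectRing K p := PerfectRing.ofSurjective K p fun x => IsAlgClosed.exists_pow_nat_eq x hp.out.pos
  obtain ⟨θ, h, h0, hs, h1, -⟩ := exists_clean_translate_hyp_eq_step p hj hbj s hperm
  -- the re-centring of record of the `x_j`-chart: translation by `b`, then cleaning by `h`
  let Θⱼ : A 4 K ≃ₐ[K] A 4 K := (AffinePointBlowup.translateEquiv (Fin.cases 0 b)).trans θ
  have hΘ0 : Θⱼ (X 0) = X 0 + rename Fin.succ h := by
    change θ (AffinePointBlowup.translateEquiv (Fin.cases 0 b) (X 0)) = _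
    rw [AffinePointBlowup.translateEquiv_X, Fin.cases_zero, C_0, add_zero, h0]
  have hΘs : ∀ i : Fin 4, Θⱼ (X i.succ) = X i.succ + C (b i) := fun i => by
    change θ (AffinePointBlowup.translateEquiv (Fin.cases 0 b) (X i.succ)) = _
    rw [AffinePointBlowup.translateEquiv_X, Fin.cases_succ, map_add, hs]
    exact congrArg _ (θ.commutes (b i))
  have hread : Θⱼ (coordBlowupSubst K (insert 0 (Fin.succ '' (S : Set (Fin 4)))) j.succ (hyp p s.F)) =
      X j.succ ^ p * hyp p (CentreBlowup.step p S j b s).F := by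
    change θ (AffinePointBlowup.translateEquiv (Fin.cases 0 b) _) = _
    rw [← h1]
    rfl
  haveI hiso : IsIso (CommRingCat.ofHom (Θⱼ : A 4 K →+* A 4 K)) :=
    (inferInstance : IsIso Θⱼ.toRingEquiv.toCommRingCatIso.hom)
  refine ⟨Θⱼ, h, hiso, hΘ0, hΘs, ⟨?_, ?_, ?_, ?_, ?_⟩, ?_, fun l hl hlS' hjl => ?_⟩
  · exact comap_chart_transform_ideal_of_reading hj hbj hΘ0 hΘs hπ hperm hread _ rfl rfl
  · exact comap_globalCentre _ _
  · exact isRegular_globalCentre_of_reading_of_not_mem hj hjS' hbj hΘ0 hΘs hπ hperm hread hperm'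
  · exact support_globalCentre_subset_support_transform hj hbj hΘ0 hΘs hπ hperm hread hperm'
  · exact hasSNCWith_transform_boundary_globalCentre_of_not_mem hj hjS' hbj hΘ0 hΘs hπ hperm hread hperm'
  · exact support_globalCentre_subset_iUnion hj hjS' hbj hΘ0 hΘs hπ hperm hread hperm'
  · exact exists_shear_chart_reading hj hjS' hbj hF hclean hΘ0 hΘs hπ hperm hread hperm' hl hlS' hjl

end ChartDictionary

end Summit.ResolutionOfSingularities.ResolutionOfSingularities.Theorems.PIDim4

end
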